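import Summits.MatrixMultiplication.MatrixMultiplication.Theorems.EdgePencilSixthCertificates
import Literature.Computability.AlgebraicComplexity.BigCwFourthOmega

/-!
# Sixth-edge ladder — the CHORD's duality side, typed once (negative knowledge for `TetraExcessZero`)

Helper kernel for `stmt-MatrixMultiplication-26697` (`TetraExcessZero : ω(K₄) ≤ ω(2,1,2)`, the attacked
leaf of route `TetrahedronCarving`, cut of record `closes (TetraExcessZero) (TetraPlusTwo) : ω = 2`,
UNCHANGED).  **Credit: this file is the ideation kernel of seat `cruxidea-stmt-MatrixMultiplication-26697-2`
g0 (technique «SPECTRAL TRANSFER / duality side», 2026-08-31), landed verbatim up to namespace / citation keys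
by `decomp-mm-lens-6` g31 on the route-writer's task t1 (critic-endorsed).**  NOTATION as in
`EdgePencilSixthLadder` / `…Certificates`: `χ = omegaSix ℂ` (exponent of the truncated pencil
`W_n^{(e)} = sixTetra F n e`, sixth edge of size `e = ⌈n^δ⌉`), `ψ = χ(0) = ω(2,1,2)`, `T = χ(1) = ω(K₄)`,
`D_n` the diamond `K₄ − 01`, registered skeleton `Cruxes/TetraExcessZero/Lines/rung_and_chord.lean` with stubs
`stub_sixRungPos : ∃ δ > 0, χ(δ) ≤ ψ` (RUNG) and `stub_midTight : ψ + T ≤ 2·χ(1/2)` (CHORD).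

**Purpose = NEGATIVE KNOWLEDGE, typed once and importable** (by `cruxidea-…-26697-1` and any later chord
seat): nothing here is a new stub, line or item (no `sorry`); the file TYPES the duality side of the chord so
that the ideation census «IDEAS 0 / CENSUS 0 of 11» is a statement about declarations.

* §1 `IsPencilDualPair F a b` — the minimal typed DUAL OBJECT on the pencil: a pointwise power lower bound
  `n^a · e^b ≤ R₄(W_n^{(e)})` (`1 ≤ e ≤ n`).  Every point `φ` of the 4-party asymptotic spectrum restricted
  to the `K₄`-EPR semiring gives one (`a = Σ_{uv ≠ 01} β_uv(φ)`, `b = β_01(φ)`), but so does any lower-bound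
  method; WEAK DUALITY `a + δ·b ≤ χ(δ)` on `[0,1]` (`affine_le_omegaSix_of_dualPair`) is all the assembly
  below uses — the Strassen axioms (multiplicativity / additivity / monotonicity of `φ`) add nothing on this
  two-generator semiring.
* §2 `CommonMaxPencil` (an explicit hypothesis `∃ a b, IsPencilDualPair ℂ a b ∧ 0 ≤ b ∧ ψ ≤ a ∧ T ≤ a + b`,
  not a definition) — «one dual pair is simultaneously `D`-optimal (`a ≥ ψ`) and `T(K₄)`-optimal (`a + b ≥ T`)».  It implies MidTight (`midTight_of_commonMaxPencil`) and, with the rung, the crux BY NAME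
  (`tetraExcessZero_of_sixRungPos_of_commonMaxPencil`).  The converse (MidTight ⟹ a common maximiser, via
  the finite-level Fekete bound `R₄(W_n^{(e)}) ≥ n^{χ(log_n e)}` and the chord `ℓ(δ) = ψ + δ(T−ψ) ≤ χ(δ)`)
  makes it EQUIVALENT to the stub: as a replacement stub it would be costume (trap T3); it is recorded as
  the typed form of the verdict «strong (Strassen) duality = weak (Fenchel) duality for the chord».
* §3 `commonMax_witness_exact` / `_cases` — trap T1 on the spectral side: a common maximiser COMPUTES `ψ`
  and `T` exactly (`a = ψ`, `a + b = T`), so an EXPLICIT one either has `a = 4` (then `HalfAlpha`, `ψ = 4`)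
  or refutes `ω = 2`.  All explicit spectral points known in print (quantum functionals and their groupings,
  Alman–Li–Pratt 2026 §3.2 p. 25; the Wigderson–Zuiddam interpolants cited there) evaluate on graph tensors
  inside the convex hull of CUT values, hence `≤ 4 = maxcut` along the whole pencil: they can witness
  `CommonMaxPencil` only if `ψ = 4` — consistent with the closed collapse window
  (`TetraCollapseWindowClosed.collapseExponents_eq_Iic'`, trap T7).
* §4 `chordCertificate_*` — the chord analogue of `leafCertificate_noCatalyst` /
  `rungCertificate_blockDominated`: a MidTight certificate by a monomial degeneration
  `T(K₄)_k ⊠ D_k ⊵ ⟨k^a⟩ ⊠ D_k^{⊠b}` (resp. `⊵ ⟨k^a⟩ ⊠ T(K₄)_k^{⊠c}`), whose feasibility is tested only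
  against the two gauge points `ζ_{0|123}` (values `k²` on `D_k`, `k³` on `T_k`) and `ζ_{01|23}` (`k⁴`, `k⁴`),
  already forces `T ≤ ψ` (resp. is infeasible): relative degeneration certificates for the chord are
  CIRCULAR exactly as absorption certificates for the rung are block-dominated.
* §5 `no_sixDiamond_commonPoint` — a point optimal for all six diamonds and `T(K₄)` would force
  `T = 6ψ/5 ≥ 4.8 > 2ω`; the MidTight point is a non-symmetric extreme point of the `T`-optimal face, and
  `S₄`-averaging / minimax moves away from it (quantitatively: symmetrisation yields only
  `T ≤ 6χ(δ)/(5+δ)`, `EdgePencilSixthSymmetrisationExponent`).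

The precise IDEA-NEEDED residue recorded by the critic / writer (TREE v56): a genuinely 4-PARTY,
non-cut-valued, non-symmetric dual pair `(ψ, T − ψ)`; the only objects of that kind in print are the
non-quantum-functional edge points of Alman–Li–Pratt 2026, Prop. 1.1 (d ≥ 4), and they interpolate downward.

References: Strassen 1988, Thm 3.2 (duality), Thm 6.5 [Strassen1988]; Alman–Li–Pratt, arXiv:2604.01386,
Thm 2.1–2.3, §3.2 p. 25, Prop. 1.1, Remark 3.2 [AlmanLiPratt2026]; Christandl–Vrana–Zuiddam, arXiv:1609.07476,
Def. 1.1.25, §1.3 [ChristandlVranaZuiddam2016]; Bürgisser–Clausen–Shokrollahi 1997, p. 455 (`R̃` additive on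
`ℕ[b]`), Ex. (15.12) p. 453 (Schönhage's 1981 example: border rank is not additive)
[BurgisserClausenShokrollahi1997] [Schonhage1981]; Le Gall 2012 §1 / Le Gall 2014 Thm 1 [LeGall2012] [LeGall2014].

Sorry-free; one `Prop`-valued definition with parameters (`IsPencilDualPair F a b`, a SHAPE of hypothesis
like `Forces` / `StableAlong`, no new notion; `CommonMaxPencil` is spelled out as a hypothesis), no instance, no
notation, no new axiom; linear / quadratic real arithmetic on recorded exponent
inequalities.
-/

set_option linter.dupNamespace false

open Filter Asymptotics Literature.Computability.AlgebraicComplexity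
open Summit.MatrixMultiplication.MatrixMultiplication.Theorems.TetrahedronTensor
open Summit.MatrixMultiplication.MatrixMultiplication.Theorems.TetraDiagonal
open Summit.MatrixMultiplication.MatrixMultiplication.Theorems.EdgePencil
open Summit.MatrixMultiplication.MatrixMultiplication.Theses.TetrahedronCarving

namespace Summit.MatrixMultiplication.MatrixMultiplication.Theorems.EdgePencil

/-! ## §1 The typed dual object and weak duality -/

section DualPairs

variable (F : Type) [Field F]

/-- **Pencil dual pair** `(a, b)`: a pointwise power lower bound `n^a · e^b ≤ R₄(W_n^{(e)})` on the whole
pencil (`1 ≤ e ≤ n`). A restriction-monotone multiplicative functional `φ` with edge exponents `β(φ)`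
on the `K₄`-EPR semiring gives the pair `(Σ_{uv≠01} β_uv, β_01)`; flattenings give `(4, 0)` and `(3, 1)`.
A SHAPE OF HYPOTHESIS (like `Forces` / `StableAlong` of `TetraResidualNecessityCore`), not a fact: nothing is
claimed about which pairs are dual pairs (Strassen 1988 Thm 3.2 and Alman–Li–Pratt 2026 Thm 2.1 supply examples). -/
def IsPencilDualPair (a b : ℝ) : Prop :=
  ∀ n e : ℕ, 1 ≤ e → e ≤ n → (n : ℝ) ^ a * (e : ℝ) ^ b ≤ (tensorRankD (sixTetra F n e) : ℝ)

/-- Exponent comparison: an eventual pointwise lower bound `n^γ ≤ f n` and `f = O(n^β)` give `γ ≤ β`.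
[folklore] -/
theorem le_of_eventually_rpow_le_of_isBigO {γ β : ℝ} {f : ℕ → ℝ}
    (hlow : ∀ᶠ n : ℕ in atTop, (n : ℝ) ^ γ ≤ f n)
    (hβ : f =O[atTop] fun n : ℕ => (n : ℝ) ^ β) : γ ≤ β := by
  by_contra hlt
  rw [not_le] at hlt
  obtain ⟨C, hC⟩ := isBigO_iff.1 hβ
  have hev : ∀ᶠ n : ℕ in atTop, (n : ℝ) ^ (γ - β) ≤ C := by
    filter_upwards [hC, hlow, eventually_gt_atTop 0] with n hn hlo hn0
    have hn0' : (0 : ℝ) < n := Nat.cast_pos.2 hn0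
    have hfn : 0 ≤ f n := (Real.rpow_nonneg hn0'.le γ).trans hlo
    rw [Real.norm_of_nonneg hfn, Real.norm_of_nonneg (Real.rpow_nonneg hn0'.le _)] at hn
    rw [Real.rpow_sub hn0', div_le_iff₀ (Real.rpow_pos_of_pos hn0' _)]
    exact hlo.trans hn
  have hlim : Tendsto (fun n : ℕ => (n : ℝ) ^ (γ - β)) atTop atTop :=
    (tendsto_rpow_atTop (by linarith)).comp tendsto_natCast_atTop_atTop
  obtain ⟨n, hn₁, hn₂⟩ := (hev.and (hlim.eventually_gt_atTop C)).exists
  exact absurd hn₁ (not_le.2 hn₂)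

/-- **Weak duality on the pencil**: a dual pair `(a, b)` with `b ≥ 0` is an affine minorant of the
sixth-edge exponent, `a + δ·b ≤ χ(δ)` for `δ ∈ [0,1]` (evaluate at `e = ⌈n^δ⌉ ≥ n^δ`). This is the only
property of spectral points the chord assembly can use. [cite: Strassen1988, Thm 3.2];
[cite: ChristandlVranaZuiddam2016, Def. 1.1.25] -/
theorem affine_le_omegaSix_of_dualPair {a b : ℝ} (hab : IsPencilDualPair F a b) (hb : 0 ≤ b)
    {δ : ℝ} (hδ1 : δ ≤ 1) : a + δ * b ≤ omegaSix F δ := by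
  refine le_csInf (sixAdmissibleExponents_nonempty F δ) fun β hβ => ?_
  refine le_of_eventually_rpow_le_of_isBigO
    (f := fun n : ℕ => (tensorRankD (sixTetra F n (rectDim n δ)) : ℝ)) ?_ hβ
  filter_upwards [eventually_ge_atTop 1] with n hn
  have hn' : (0 : ℝ) < n := by exact_mod_cast hn
  have he1 : 1 ≤ rectDim n δ := one_le_rectDim hn δ
  have hen : rectDim n δ ≤ n := (rectDim_mono hn hδ1).trans (rectDim_one n).le
  have hge : (n : ℝ) ^ δ ≤ (rectDim n δ : ℝ) := Nat.le_ceil _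
  have h := hab n (rectDim n δ) he1 hen
  calc (n : ℝ) ^ (a + δ * b) = (n : ℝ) ^ a * ((n : ℝ) ^ δ) ^ b := by
        rw [Real.rpow_add hn', Real.rpow_mul hn'.le]
    _ ≤ (n : ℝ) ^ a * (rectDim n δ : ℝ) ^ b :=
        mul_le_mul_of_nonneg_left (Real.rpow_le_rpow (Real.rpow_nonneg hn'.le _) hge hb)
          (Real.rpow_nonneg hn'.le _)
    _ ≤ _ := h

/-- The two ends: a dual pair has intercept `a ≤ ψ = χ(0)` and total `a + b ≤ T = χ(1)`. -/
theorem dualPair_le_ends {a b : ℝ} (hab : IsPencilDualPair F a b) (hb : 0 ≤ b) :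
    a ≤ omegaRect F 2 1 2 ∧ a + b ≤ omegaTetra F := by
  have h0 := affine_le_omegaSix_of_dualPair F hab hb (δ := 0) zero_le_one
  have h1 := affine_le_omegaSix_of_dualPair F hab hb (δ := 1) le_rfl
  rw [zero_mul, add_zero, omegaSix_zero] at h0
  rw [one_mul, omegaSix_one] at h1
  exact ⟨h0, h1⟩

end DualPairs

/-! ## §2 The common-maximiser form of the chord (typed; equivalent to MidTight, hence NOT a stub) -/

section CommonMax

/-! **Common maximiser on the pencil** (`CommonMaxPencil`, written below as the explicit hypothesis
`h : ∃ a b, IsPencilDualPair ℂ a b ∧ 0 ≤ b ∧ ψ ≤ a ∧ T ≤ a + b` — an OPEN route-internal statement, kept as a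
hypothesis and deliberately NOT a definition): some dual pair is at once `D`-optimal (`ψ ≤ a`) and
`T(K₄)`-optimal (`T ≤ a + b`). Spectrally: the `D`-optimal face and the `T(K₄)`-optimal face of the
`K₄`-EPR spectrum meet (`F_D ∩ F_T ≠ ∅`); semiring-theoretically: asymptotic rank is ADDITIVE on the pair
`(D, T(K₄))` (it is additive on every one-generator semiring `ℕ[b]`, BCS p. 455; additivity on a
general pair is exactly the existence of a common maximising spectral point and is not known in general —
BORDER rank is not additive, Schönhage's 1981 example, BCS Ex. (15.12) p. 453; Strassen 1988 Thm 3.2 / 6.5). -/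

/-- **A common maximiser gives the chord bound at the midpoint** (weak duality at `δ = 1/2`):
`ψ + T ≤ a + (a + b) = 2(a + b/2) ≤ 2χ(1/2)`. This is `stub_midTight`'s statement. -/
theorem midTight_of_commonMaxPencil
    (h : ∃ a b : ℝ, IsPencilDualPair ℂ a b ∧ 0 ≤ b ∧ omegaRect ℂ 2 1 2 ≤ a ∧ omegaTetra ℂ ≤ a + b) :
    omegaRect ℂ 2 1 2 + omegaTetra ℂ ≤ 2 * omegaSix ℂ (1 / 2) := by
  obtain ⟨a, b, hab, hb, hψ, hT⟩ := h
  have hmid := affine_le_omegaSix_of_dualPair ℂ hab hb (δ := 1 / 2) (by norm_num)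
  linarith

/-- … in fact the whole chord: `ψ + δ(T - ψ) ≤ χ(δ)` on `[0,1]` (so `χ` is affine there, given convexity). -/
theorem chord_le_omegaSix_of_commonMaxPencil
    (h : ∃ a b : ℝ, IsPencilDualPair ℂ a b ∧ 0 ≤ b ∧ omegaRect ℂ 2 1 2 ≤ a ∧ omegaTetra ℂ ≤ a + b)
    {δ : ℝ} (hδ0 : 0 ≤ δ) (hδ1 : δ ≤ 1) :
    omegaRect ℂ 2 1 2 + δ * (omegaTetra ℂ - omegaRect ℂ 2 1 2) ≤ omegaSix ℂ δ := by
  obtain ⟨a, b, hab, hb, hψ, hT⟩ := h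
  have hδ' := affine_le_omegaSix_of_dualPair ℂ hab hb hδ1
  have haψ : a ≤ omegaRect ℂ 2 1 2 := (dualPair_le_ends ℂ hab hb).1
  have h1δ : 0 ≤ 1 - δ := by linarith
  nlinarith [mul_le_mul_of_nonneg_left hT hδ0, mul_le_mul_of_nonneg_left hψ h1δ]

/-- **The crux BY NAME from the rung and a common maximiser** (composition with the registered seam
`tetraExcessZero_of_sixRungPos_of_midTight`). -/
theorem tetraExcessZero_of_sixRungPos_of_commonMaxPencil
    (hr : ∃ δ : ℝ, 0 < δ ∧ omegaSix ℂ δ ≤ omegaRect ℂ 2 1 2)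
    (h : ∃ a b : ℝ, IsPencilDualPair ℂ a b ∧ 0 ≤ b ∧ omegaRect ℂ 2 1 2 ≤ a ∧ omegaTetra ℂ ≤ a + b) :
    TetraExcessZero :=
  tetraExcessZero_of_sixRungPos_of_midTight hr (midTight_of_commonMaxPencil h)

end CommonMax

/-! ## §3 Trap T1 on the spectral side: a common maximiser is an exact formula for `ψ` and `T` -/

section Exactness

/-- **A common maximiser computes both ends exactly**: `a = ψ` and `a + b = T`. Hence exhibiting one
EXPLICITLY is computing `ω(2,1,2) = 2·ω(1,1/2,1)` and `ω(K₄)` on the nose. [cite: LeGall2012, §1] -/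
theorem commonMax_witness_exact {a b : ℝ} (hab : IsPencilDualPair ℂ a b) (hb : 0 ≤ b)
    (hψ : omegaRect ℂ 2 1 2 ≤ a) (hT : omegaTetra ℂ ≤ a + b) :
    a = omegaRect ℂ 2 1 2 ∧ a + b = omegaTetra ℂ :=
  ⟨le_antisymm (dualPair_le_ends ℂ hab hb).1 hψ, le_antisymm (dualPair_le_ends ℂ hab hb).2 hT⟩

/-- **… so an explicit witness is all-or-nothing**: either its intercept is `a = 4` — then `ψ = 4`, i.e.
`HalfAlpha` (`α ≥ 1/2`), and `T = 4 + b` — or `a > 4` and the witness REFUTES `ω = 2`. Every explicit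
spectral point in print (quantum functionals, their groupings, the Wigderson–Zuiddam interpolants cited by Alman–Li–Pratt) takes values in the
convex hull of cut values on graph tensors, `≤ 4` along the pencil, so it is in the first case and can be a
common maximiser only if `ψ = 4`. [cite: AlmanLiPratt2026, §3.2 p. 25, Remark 3.2];
[cite: ChristandlVranaZuiddam2016, §1.3] -/
theorem commonMax_witness_cases {a b : ℝ} (hab : IsPencilDualPair ℂ a b) (hb : 0 ≤ b)
    (hψ : omegaRect ℂ 2 1 2 ≤ a) (hT : omegaTetra ℂ ≤ a + b) :
    (a = 4 ∧ HalfAlpha ∧ omegaTetra ℂ = 4 + b) ∨ (4 < a ∧ ¬ _root_.MatrixMultiplication) := by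
  obtain ⟨haψ, habT⟩ := commonMax_witness_exact hab hb hψ hT
  have h4 : 4 ≤ a := haψ ▸ four_le_omegaRect_two_one_two ℂ
  rcases h4.eq_or_lt with h | h
  · refine Or.inl ⟨h.symm, ?_, by linarith⟩
    exact (omegaRect_two_one_two_le_four_iff_half_le_dualExponentAlpha ℂ).1 (by linarith)
  · refine Or.inr ⟨h, not_matrixMultiplication_of_four_lt_omegaSix (δ := 0) ?_⟩
    rw [omegaSix_zero]; linarith

end Exactness

/-! ## §4 Relative degeneration certificates for the chord are circular (gauge-point arithmetic) -/

section ChordCertificates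

/-- **Catalysed-diamond chord certificate ⟹ the crux.** A degeneration
`T(K₄)_k ⊠ D_k ⊵ ⟨k^a⟩ ⊠ D_k^{⊠b}` would certify `2χ(1/2) ≥ a + bψ`; feasibility against the single gauge
point `ζ_{01|23}` (`k^{4+4} ≥ k^{a+4b}`) already caps `a + bψ ≤ 2ψ` once `ψ ≥ 4`, so reaching the chord value
`ψ + T` forces `T ≤ ψ` — the certificate exists only if the crux already holds (with `b = 2`, `a = 0`: the
restriction `T(K₄) ⊵ D`). Exponent-level statement. [cite: Strassen1988, Thm 3.2] -/
theorem chordCertificate_diamondMonomial {a b ψ T : ℝ} (ha : 0 ≤ a) (h01 : a + 4 * b ≤ 8)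
    (hψ4 : 4 ≤ ψ) (hcert : ψ + T ≤ a + b * ψ) : T ≤ ψ := by
  have hb2 : b ≤ 2 := by linarith
  nlinarith [mul_nonneg (sub_nonneg.2 hb2) (sub_nonneg.2 hψ4)]

/-- **Catalysed-tetrahedron chord certificate: infeasible.** `T(K₄)_k ⊠ D_k ⊵ ⟨k^a⟩ ⊠ T(K₄)_k^{⊠c}` would
certify `2χ(1/2) ≥ a + cT`; the single gauge point `ζ_{0|123}` (`k^{3+2} ≥ k^{a+3c}`) caps `a + cT ≤ 5T/3`,
which is below `ψ + T` whenever `T ≤ ψ + 1` (true: `omegaTetra_le_omegaSix_add`) and `ψ ≥ 4`.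
[cite: Strassen1988, Thm 3.2] -/
theorem chordCertificate_tetraMonomial_infeasible {a c ψ T : ℝ} (ha : 0 ≤ a) (h0 : a + 3 * c ≤ 5)
    (hψ4 : 4 ≤ ψ) (hψT : ψ ≤ T) (hT1 : T ≤ ψ + 1) (hcert : ψ + T ≤ a + c * T) : False := by
  have hc' : c ≤ 5 / 3 := by linarith
  have hT3 : 0 ≤ T - 3 := by linarith
  nlinarith [mul_nonneg (sub_nonneg.2 hc') hT3]

/-- The diamond certificate instantiated at the true exponents: a catalysed-diamond chord certificate feasible
against `ζ_{01|23}` proves `TetraExcessZero` outright (so it is not a route to the chord short of the crux),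
and a catalysed-tetrahedron one cannot exist. -/
theorem tetraExcessZero_of_diamondChordCertificate {a b : ℝ} (ha : 0 ≤ a) (h01 : a + 4 * b ≤ 8)
    (hcert : omegaRect ℂ 2 1 2 + omegaTetra ℂ ≤ a + b * omegaRect ℂ 2 1 2) : TetraExcessZero :=
  chordCertificate_diamondMonomial ha h01 (four_le_omegaRect_two_one_two ℂ) hcert

/-- **No catalysed-tetrahedron chord certificate exists** at the true exponents (`ψ ≥ 4`, `ψ ≤ T ≤ ψ + 1`):
the gauge point `ζ_{0|123}` alone rules it out. [cite: Strassen1988, Thm 3.2] -/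
theorem no_tetraChordCertificate {a c : ℝ} (ha : 0 ≤ a) (h0 : a + 3 * c ≤ 5)
    (hcert : omegaRect ℂ 2 1 2 + omegaTetra ℂ ≤ a + c * omegaTetra ℂ) : False :=
  chordCertificate_tetraMonomial_infeasible ha h0 (four_le_omegaRect_two_one_two ℂ)
    (omegaRect_two_one_two_le_omegaTetra ℂ)
    (by have h := omegaTetra_le_omegaSix_add ℂ (δ := 0) zero_le_one
        rw [omegaSix_zero] at h
        linarith) hcert

end ChordCertificates

/-! ## §5 Instruction (c): symmetry pushes the wrong way — no `S₄`-symmetric common point -/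

section Symmetry

/-- **The six diamonds and the tetrahedron share no optimal spectral point.** If one point `β ∈ B` were
optimal for every diamond `D^{(uv)}` (`Σ_{e≠uv} β_e = ψ`, the same `ψ` for all six by `Aut K₄`) and for
`T(K₄)` (`Σ_e β_e = T`), summing the six diamond equations gives `5T = 6ψ`, i.e. `T = 6ψ/5 ≥ 4.8`; but
`T ≤ 2ω ≤ 4.7459`. So the MidTight point (optimal for ONE diamond and `T`) is necessarily NON-symmetric —
an extreme point `min_{F_T} β_01 = T - ψ < T/6` of the `T`-optimal face, which `S₄`-averaging (barycentre
`(T/6)·𝟙 ∈ F_T`) moves away from; and `Aut(D) = ℤ₂²` fixes the edge `01`, so no exchange argument is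
available either. Exponent-level statement. [cite: ChristandlVranaZuiddam2016, §1.3]; [cite: LeGall2014, Thm 1] -/
theorem no_sixDiamond_commonPoint (β : Fin 6 → ℝ)
    (hD : ∀ i, (∑ j, β j) - β i = omegaRect ℂ 2 1 2) (hT : ∑ j, β j = omegaTetra ℂ) : False := by
  have hsum : ∑ i, ((∑ j, β j) - β i) = 6 * omegaRect ℂ 2 1 2 := by
    simp only [hD, Finset.sum_const, Finset.card_univ, Fintype.card_fin, nsmul_eq_mul, Nat.cast_ofNat]
  have h5 : ∑ i, ((∑ j, β j) - β i) = 5 * ∑ j, β j := by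
    rw [Finset.sum_sub_distrib, Finset.sum_const, Finset.card_univ, Fintype.card_fin, nsmul_eq_mul]
    push_cast; ring
  have hT2 := omegaTetra_le_two_mul_omega ℂ
  have hω := LeGall2014_cw4_omega_le ℂ
  have hψ := four_le_omegaRect_two_one_two ℂ
  rw [h5, hT] at hsum
  norm_num at hω
  linarith

end Symmetry

end Summit.MatrixMultiplication.MatrixMultiplication.Theorems.EdgePencil
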